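import Literature.NumberTheory.GaloisCohomology.Howard2004.TransportUnramified
import Literature.NumberTheory.GaloisRepresentations.UnramifiedCupProductZero
import HarnessLib

/-!
# Howard 2004, H.4: the unramified conditions at `v` and `v̄` are ISOTROPIC under the induced local
# pairing, at every finite place (ramified or not)

Topic `NumberTheory/GaloisCohomology/Howard2004` (sequel to `TransportUnramified` and
`GaloisRepresentations/UnramifiedCupProductZero`; theorems only — no definition, no named fact, no instance, no `sorry`).

For Howard's H.4 datum `D` on a discrete `Γ_K`-module `T` over a `p`-PRIMARY level ring `R` (e.g. `A_{m,k} =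
Λ/(T^m + p, p^k)`), at every finite place `v` of `K`:

* `DualityDatum.localCup_eq_zero_of_mem_unramifiedSubgroup` — `x ∪_e y = 0` in `H²(K_v, R(1))` for
  `x ∈ H¹_ur(K_v, T)`, `y ∈ H¹_ur(K_v, Tw T)` (the tree's `ContPairing.cupProduct_eq_zero_of_mem_unramifiedSubgroup`:
  inflation from `H²(Gal(K_v^nr/K_v), R(1)^{I}) = 0`);
* **`DualityDatum.localCup_transportH1_eq_zero_of_mem_unramifiedSubgroup`** — `x ∪_e τ_* y' = 0` for
  `x ∈ H¹_ur(K_v, T)` and `y' ∈ H¹_ur(K_v̄, T)`, for every conjugation datum whose local transport maps `I_{K_v}`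
  into `I_{K_v̄}` (e.g. `ConjugationDatum.ofLifts`, `phi_mem_absInertia_iff`): the levelwise ISOTROPY of the unramified
  cores `C_j = H¹_ur(K_v, T_𝔮/𝔪^j)`, `C′_j = H¹_ur(K_v̄, T_𝔮/𝔪^j)` — hypothesis `hC` of the saturated-condition descent
  `Tower.pairing_eq_zero_of_mem_levelCondition` / `levelCondition_mem_iff_forall_pairing_eq_zero`
  (`EllipticCurves/TowerSaturatedAnnihilatorProofs`) for Howard's `F_𝔮` at the places `v ∣ N` (where the levels are
  RAMIFIED and Milne I 2.6 does not apply), and the «→» halves of `IsSelfOrthogonalAt` for the plain unramified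
  conditions (`isotropic_unramifiedSubgroup`);
* `ofLifts_localCup_transportH1_eq_zero_of_mem_unramifiedSubgroup` — the same for the canonical datum.

BSD is not proved by any of this.

References: [Howard2004HeegnerKolyvagin] B. Howard, Compositio Math. 140 (2004), §1.3 H.4 (arXiv:1202.6340 p. 7 L69–82),
Def. 3.2.6 (p. 16); [MilneADT2006] I Thm. 2.6; [Rubin2011] Prop. 1.9.1, Ex. 1.9.3.
-/

noncomputable section

open Function NumberField IsDedekindDomain Field
open scoped NumberField

namespace Literature.NumberTheory.GaloisCohomology.Howard2004

open Literature.NumberTheory.GaloisRepresentations Literature.NumberTheory.GaloisRepresentations.DiscreteGaloisModule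

namespace DualityDatum

variable {K : Type} [Field K] [NumberField K] {M : Type} [AddCommGroup M] [TopologicalSpace M]
  [DiscreteTopology M] {R : Type} [CommRing R] [Module R M] [TopologicalSpace R] [DiscreteTopology R]
  {p : ℕ} [Fact p.Prime] [Algebra ℤ_[p] R] {cd : ConjugationDatum K} {ρ : DiscreteGaloisModule K M}
  (D : DualityDatum p cd ρ R)

/-- **`x ∪_e y = 0` for unramified `x ∈ H¹_ur(K_v, T)`, `y ∈ H¹_ur(K_v, Tw T)`** under the induced local pairing
`H¹(K_v, T) × H¹(K_v, Tw T) → H²(K_v, R(1))` of H.4, at EVERY finite place `v` (the module may be ramified), for a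
`p`-primary level ring `R`. [cite: Howard2004HeegnerKolyvagin, §1.3 H.4 (arXiv p. 7, L78–82)] [cite: MilneADT2006, Ch. I, Thm. 2.6] -/
theorem localCup_eq_zero_of_mem_unramifiedSubgroup (hR : IsPrimaryTorsion p R) (v : HeightOneSpectrum (𝓞 K))
    {x : galoisCohomology (GaloisRep.toLocal v ρ) 1} (hx : x ∈ unramifiedSubgroup (GaloisRep.toLocal v ρ) 1)
    {y : galoisCohomology (GaloisRep.toLocal v (cd.twist ρ)) 1}
    (hy : y ∈ unramifiedSubgroup (GaloisRep.toLocal v (cd.twist ρ)) 1) :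
    D.localCup (Sum.inr v) x y = 0 :=
  ContPairing.cupProduct_eq_zero_of_mem_unramifiedSubgroup (ρ₃ := GaloisRep.toLocal v D.twistOne) hR
    (D.ePairingLocal (Sum.inr v)) hx hy

/-- Both «→» halves of `IsSelfOrthogonalAt` for the unramified conditions: `H¹_ur(K_v, T)` and `H¹_ur(K_v, Tw T)` are
ISOTROPIC for `∪_e` (the converse inclusions are Milne I 2.6 / local Tate duality, `UnramifiedSelfOrthogonal.lean`).
[cite: Howard2004HeegnerKolyvagin, §1.3 H.4 (arXiv p. 7, L78–82)] [cite: MilneADT2006, Ch. I, Thm. 2.6] -/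
theorem isotropic_unramifiedSubgroup (hR : IsPrimaryTorsion p R) (v : HeightOneSpectrum (𝓞 K)) :
    (∀ x ∈ unramifiedSubgroup (GaloisRep.toLocal v ρ) 1, ∀ y ∈ unramifiedSubgroup (GaloisRep.toLocal v (cd.twist ρ)) 1,
        D.localCup (Sum.inr v) x y = 0) ∧
      ∀ y ∈ unramifiedSubgroup (GaloisRep.toLocal v (cd.twist ρ)) 1, ∀ x ∈ unramifiedSubgroup (GaloisRep.toLocal v ρ) 1,
        D.localCup (Sum.inr v) x y = 0 :=
  ⟨fun _ hx _ hy => D.localCup_eq_zero_of_mem_unramifiedSubgroup hR v hx hy,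
    fun _ hy _ hx => D.localCup_eq_zero_of_mem_unramifiedSubgroup hR v hx hy⟩

/-- **`x ∪_e τ_* y' = 0` for `x ∈ H¹_ur(K_v, T)`, `y' ∈ H¹_ur(K_v̄, T)`** — the levelwise ISOTROPY of the unramified cores
at `v` and `v̄ = σ v` under the induced local pairing composed with the transport, for every conjugation datum whose
local transport `φ_v` maps `I_{K_v}` into `I_{K_v̄}`; the input `hC` of `Tower.pairing_eq_zero_of_mem_levelCondition`
for Howard's saturated unramified condition at the places `v ∣ N`.
[cite: Howard2004HeegnerKolyvagin, §1.3 H.4 and Def. 3.2.6 (arXiv p. 7 L78–82, p. 16)] [cite: MilneADT2006, Ch. I, Thm. 2.6] -/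
theorem localCup_transportH1_eq_zero_of_mem_unramifiedSubgroup (hR : IsPrimaryTorsion p R)
    (v : HeightOneSpectrum (𝓞 K))
    (hI : ∀ g ∈ absInertia (v.adicCompletion K), cd.φ v g ∈ absInertia ((cd.σ • v).adicCompletion K))
    {x : galoisCohomology (GaloisRep.toLocal v ρ) 1} (hx : x ∈ unramifiedSubgroup (GaloisRep.toLocal v ρ) 1)
    {y' : galoisCohomology (GaloisRep.toLocal (cd.σ • v) ρ) 1}
    (hy' : y' ∈ unramifiedSubgroup (GaloisRep.toLocal (cd.σ • v) ρ) 1) :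
    D.localCup (Sum.inr v) x (cd.transportH1 ρ v y') = 0 :=
  D.localCup_eq_zero_of_mem_unramifiedSubgroup hR v hx
    (cd.map_transportH1_unramifiedSubgroup_le ρ v hI ⟨y', hy', rfl⟩)

/-- The same for the canonical conjugation datum `ConjugationDatum.ofLifts` (its transport matches the inertia groups,
`phi_mem_absInertia_iff`). [cite: Howard2004HeegnerKolyvagin, §1.3 H.4 and Def. 3.2.6 (arXiv p. 7 L78–82, p. 16)] -/
theorem ofLifts_localCup_transportH1_eq_zero_of_mem_unramifiedSubgroup {σ : K ≃ₐ[ℚ] K} {hσ₁ : σ ≠ 1}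
    {hσ : σ * σ = 1} {τ : AlgebraicClosure K ≃+* AlgebraicClosure K} {hτ : EllipticCurves.IsLiftOfAut σ τ}
    {hτ₂ : Function.Involutive τ} (D : DualityDatum p (ConjugationDatum.ofLifts σ hσ₁ hσ τ hτ hτ₂) ρ R)
    (hR : IsPrimaryTorsion p R) (v : HeightOneSpectrum (𝓞 K))
    {x : galoisCohomology (GaloisRep.toLocal v ρ) 1} (hx : x ∈ unramifiedSubgroup (GaloisRep.toLocal v ρ) 1)
    {y' : galoisCohomology (GaloisRep.toLocal (σ • v) ρ) 1}
    (hy' : y' ∈ unramifiedSubgroup (GaloisRep.toLocal (σ • v) ρ) 1) :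
    D.localCup (Sum.inr v) x ((ConjugationDatum.ofLifts σ hσ₁ hσ τ hτ hτ₂).transportH1 ρ v y') = 0 :=
  D.localCup_transportH1_eq_zero_of_mem_unramifiedSubgroup hR v
    (fun g hg => (ConjugationDatum.phi_mem_absInertia_iff hσ v g).mp hg) hx hy'

end DualityDatum

end Literature.NumberTheory.GaloisCohomology.Howard2004
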